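import Summits.QuantumFields.Balaban3D.Proofs.Run3Representation
import Summits.QuantumFields.Balaban3D.Carriers.Standard

/-!
# Bałaban CMP 102 (1985) 255–275, d = 3 — prover seat p6 (lane `pub-balaban3d`): the p6 leaves at the lane's STANDARD
# tower input `Carriers.stdTowerInput X K 𝔖` (seat p1, rulings R-FL′ / R-E4‴: external inputs `X`, carrier constants
# `K`, expansion data `𝔖` — no free per-step reals), i.e. at `seriesPieces (X.toTowerBase K) 𝔖 (piecesParamsOf S K) k`,
# with the bookkeeping hypotheses of `…Proofs.Run3Representation` DISCHARGED from the definitions: the remainder unit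
# (`piecesParamsOf_rem` + seat p3's `norm_rem_eq`) and the remainder coefficient `rcoefOf` (C14 closes outright)

Source: T. Bałaban, Commun. Math. Phys. **102** (1985) 255–275 [Balaban1985UV3]; loci as in `…Proofs.Run3Representation`.
HONEST FRAMING (lane PLAN.md §0): nothing of the paper is asserted; these are the instantiations the end theorem
(`uvStability3D_of_inputs`, seat p3) consumes, by application.  PLACEMENT: `Summits/QuantumFields/Balaban3D/Proofs/`.
-/

noncomputable section

open scoped Topology
open Metric Set Finset MeasureTheory
open Literature.MathematicalPhysics.QuantumFieldTheory.Balaban1983to89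
open Literature.MathematicalPhysics.QuantumFieldTheory.Balaban1983to89.B10
open Literature.MathematicalPhysics.QuantumFieldTheory.Balaban1983to89.B10SectAGathering
open Literature.MathematicalPhysics.QuantumFieldTheory.Balaban1983to89.B10Assembly
open Literature.MathematicalPhysics.QuantumFieldTheory.Balaban1983to89.B12TreeDecay (kappa₀ K₀ K₀_pos)
open Literature.MathematicalPhysics.QuantumFieldTheory.Balaban1983to89.TreeLengthTorus (tsys tcubeSys TPt)
open Literature.MathematicalPhysics.QuantumFieldTheory.Balaban1985CMP102
open Literature.MathematicalPhysics.QuantumFieldTheory.Balaban1985CMP102.Setting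
open Literature.MathematicalPhysics.QuantumFieldTheory.Balaban1985CMP102.Binders
  (ChartAnalyticityAsCited FarTermsDecayAsCited)
open Summit.QuantumFields.Balaban3D.Proofs.Representation33
open Summit.QuantumFields.Balaban3D.Proofs.LogZLocalized
open Summit.QuantumFields.Balaban3D.Proofs.Run3Representation
open Summit.QuantumFields.Balaban3D.Carriers
open Summit.QuantumFields.Balaban3D.Proofs.ScalesArithmetic

namespace Summit.QuantumFields.Balaban3D.Proofs.Run3RepresentationStd

variable {L : ℕ} {S : Scales L} {G : Type} [GaugeGroup G] [MeasurableSpace G] [HaarData G]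
  {V : Type} [NormedAddCommGroup V] [NormedSpace ℂ V]
  (X : ExternalInputs S G) (K : CarrierConsts) (𝔖 : ∀ k, StepSeries S G V (nblkOf S K k) k) (k : ℕ)

/-- The remainder-unit equation of `…Run3Representation` holds for `piecesParamsOf` (R-NORM: `rem_k = (g_k²)^{3+κ₀}|T₁^{(k)}|
= (L^kg₀²)^{3+κ₀}|T₁^{(k)}|`, seat p1's `piecesParamsOf_rem` + seat p3's `norm_rem_eq`). [cite: Balaban1985UV3, (41) p.266] -/
theorem rem_std : (piecesParamsOf S K k).rem = ((L : ℝ) ^ k * S.g0sq) ^ (3 + K.κ₀) * S.sites k := by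
  rw [piecesParamsOf_rem, norm_rem_eq]

/-- **C5 at the standard tower**: `Repr33_60` for `seriesPieces (X.toTowerBase K) 𝔖 (piecesParamsOf S K) k` with
`C₂ := rawConst7 κc.Craw K.b₀ κc.r₀ K.p₀ 1 K.κ₀` — `repr33_60_series` with the remainder unit discharged; remaining
hypotheses = the (α) inputs G3D-01 `chart`, (28) `bound28`/`small28`, (26) `inv26` + detecting `hdet`, G3D-06 `far_le`,
the identification `hPY`, and the windows. [cite: Balaban1985UV3, (33) p.264 + (60) p.271] -/
theorem repr33_60_std [FiniteDimensional ℂ V] (hk : k ≤ S.K) (κc : ChartConsts) {κ C25 : ℝ}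
    (hκ : kappa₀ (4 * 2 ^ 3) (2 * 3) ≤ κ)
    (hC25 : 0 ≤ C25) (hCM : C25 * K₀ (4 * 2 ^ 3) (2 * 3) ≤ κc.CM) (hκ₀ : K.κ₀ < 1 / 2) (hp₀ : 0 < K.p₀)
    (hb₀ : 0 ≤ K.b₀) (hblocks : ((nblkOf S K k : ℕ) : ℝ) ^ 3 ≤ S.sites k)
    (chart : ∀ Y, ChartAnalyticityAsCited ((𝔖 k).Ψ Y) κc.ρ
      (C25 * S.gk k * Real.exp (-(κ * (tsys 3 (nblkOf S K k)).dj Y))))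
    (bound28 : ∀ Y h U, ‖(𝔖 k).Bcfg Y h U‖ ≤ κc.cB * (rFun κc.r₀ (S.gk k) * S.gk k * pFun K.b₀ K.p₀ (S.gk k)))
    (small28 : κc.cB * (rFun κc.r₀ (S.gk k) * S.gk k * pFun K.b₀ K.p₀ (S.gk k)) ≤ κc.ρ / 4)
    {Γ : Type*} (π : Γ → (𝔖 k).E →L[ℂ] (𝔖 k).E)
    (inv26 : ∀ Y u, ∀ b ∈ ball (0 : (𝔖 k).E) κc.ρ, π u b ∈ ball (0 : (𝔖 k).E) κc.ρ →
      (𝔖 k).Ψ Y (π u b) = (𝔖 k).Ψ Y b)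
    (hdet : ∀ φ : (𝔖 k).E →L[ℂ] ℂ, (∀ u, φ.comp (π u) = φ) → φ = 0)
    (far_le : FarTermsDecayAsCited (𝔖 k).far (fun Y => C25 * S.gk k * Real.exp (-(κ * (tsys 3 (nblkOf S K k)).dj Y)))
      κc.Cfar (S.gk k ^ 7 * (rFun κc.r₀ (S.gk k) * pFun K.b₀ K.p₀ (S.gk k)) ^ 7))
    (hPY : ∀ h U, (𝔖 k).PY h U
      = ∑ Y ∈ (𝔖 k).loc (ΩblkOf K.M₁ (rcolOf S K) (nblkOf S K k)) (rretOf S K k) h, ((jet26 ((𝔖 k).Ψ Y) ((𝔖 k).Bcfg Y h U)).re - (𝔖 k).far Y h U)) :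
    Repr33_60 (seriesPieces (X.toTowerBase K) 𝔖 (piecesParamsOf S K) k)
      (rawConst7 κc.Craw K.b₀ κc.r₀ K.p₀ 1 K.κ₀) :=
  repr33_60_series (X.toTowerBase K) 𝔖 (piecesParamsOf S K) k hk κc hκ hC25 hCM hκ₀ hp₀ hb₀ hblocks
    (rem_std K k) chart bound28 small28 π inv26 hdet far_le hPY

/-- **C6 at the standard tower**: `VacuumWhole` with `Cv := C25·K₀(32,6)`, `C₃ := rawConstR Cv K.R₁ 1 K.κ₀` — remaining
hypotheses = G3D-01 `chart` and the windows; the retained radius `rretOf S K k = R₁r(g_k)` is definitional (ruling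
R-OMEGA, `rfl`) and the block count `#(blocks ∖ Ω_{k+1}(h)) ≤ |Z_k(h)|` is seat p1's theorem `seriesPieces_hZ`. [cite: Balaban1985UV3, p.270 + p.265] -/
theorem vacuumWhole_std (hk : k ≤ S.K) {ρ κ C25 : ℝ} (hκ : kappa₀ (4 * 2 ^ 3) (2 * 3) + 1 ≤ κ) (hC25 : 0 ≤ C25)
    (hκ₀ : 0 < K.κ₀) (hr₀ : 1 ≤ K.r₀) (hR₁ : 6 + 2 * K.κ₀ ≤ K.R₁) (hblocks : ((nblkOf S K k : ℕ) : ℝ) ^ 3 ≤ S.sites k)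
    (chart : ∀ Y, ChartAnalyticityAsCited ((𝔖 k).Ψ Y) ρ
      (C25 * S.gk k * Real.exp (-(κ * (tsys 3 (nblkOf S K k)).dj Y)))) :
    VacuumWhole (seriesPieces (X.toTowerBase K) 𝔖 (piecesParamsOf S K) k) (C25 * K₀ (4 * 2 ^ 3) (2 * 3))
      (rawConstR (C25 * K₀ (4 * 2 ^ 3) (2 * 3)) K.R₁ 1 K.κ₀) :=
  vacuumWhole_series (X.toTowerBase K) 𝔖 (piecesParamsOf S K) k hk hκ hC25 hκ₀ hr₀ hR₁ hblocks (rem_std K k) rfl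
    chart

/-- **C7 at the standard tower**: `Decomp35_61` with `C₄ := rawConst7 κc.Craw K.b₀ K.r₀ K.p₀ 1 K.κ₀ + rawConstR
(2·C63·K₀(32,6)) K.R₁ 1 K.κ₀` — remaining hypotheses = (28) for the chart configurations and «(63) as cited» (`LogZLocalization`, the lane's GAP binder
G3D-07 `Binders.LogZLocalizedAsCited` via `LogZLocalization.ofCited`) with the identification `hPYZ`; the chart
profile's `r₀` is the carrier's (`κc.r₀ = K.r₀`, ruling R-CONST′); the retained radius `rretOf` is definitional. [cite: Balaban1985UV3, (61) p.271 + (63) p.272] -/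
theorem decomp35_61_std [FiniteDimensional ℂ V] (hk : k ≤ S.K) (κc : ChartConsts) (hr : κc.r₀ = K.r₀) {κ C63 : ℝ}
    (hκ : kappa₀ (4 * 2 ^ 3) (2 * 3) + 1 ≤ κ) (hC63 : 0 ≤ C63) (hCM : C63 * K₀ (4 * 2 ^ 3) (2 * 3) ≤ κc.CM)
    (hr₀ : 1 ≤ K.r₀) (hκ₀ : 0 < K.κ₀) (hκ₀' : K.κ₀ < 1 / 2) (hR₁ : 6 + 2 * K.κ₀ ≤ K.R₁) (hp₀ : 0 < K.p₀)
    (hb₀ : 0 ≤ K.b₀) (hblocks : ((nblkOf S K k : ℕ) : ℝ) ^ 3 ≤ S.sites k)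
    (bound28 : ∀ Y h U, ‖(𝔖 k).Bcfg Y h U‖ ≤ κc.cB * (rFun κc.r₀ (S.gk k) * S.gk k * pFun K.b₀ K.p₀ (S.gk k)))
    (small28 : κc.cB * (rFun κc.r₀ (S.gk k) * S.gk k * pFun K.b₀ K.p₀ (S.gk k)) ≤ κc.ρ / 4)
    (Λ : LogZLocalization (stdTowerInput X K 𝔖).tower3.toTowerRun k (𝔖 k).E κc κ C63
      (seriesPieces (X.toTowerBase K) 𝔖 (piecesParamsOf S K) k).logZU
      (seriesPieces (X.toTowerBase K) 𝔖 (piecesParamsOf S K) k).logZ1 (𝔖 k).Bcfg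
      (fun h => Finset.univ.filter fun Y : (tsys 3 (nblkOf S K k)).Dom =>
        Y.1 ⊆ ΩblkOf K.M₁ (rcolOf S K) (nblkOf S K k) h))
    (hPYZ : ∀ h U, (𝔖 k).PYZ h U
      = ∑ Y ∈ (𝔖 k).loc (ΩblkOf K.M₁ (rcolOf S K) (nblkOf S K k)) (rretOf S K k) h, ((jet26 (Λ.Ψ Y) ((𝔖 k).Bcfg Y h U)).re - Λ.far Y h U)) :
    Decomp35_61 (seriesPieces (X.toTowerBase K) 𝔖 (piecesParamsOf S K) k)
      (rawConst7 κc.Craw K.b₀ K.r₀ K.p₀ 1 K.κ₀ + rawConstR (2 * C63 * K₀ (4 * 2 ^ 3) (2 * 3)) K.R₁ 1 K.κ₀) := by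
  have h := decomp35_61_series (X.toTowerBase K) 𝔖 (piecesParamsOf S K) k hk κc hκ hC63 hCM (hr ▸ hr₀) hκ₀ hκ₀' hR₁
    hp₀ hb₀ hblocks (rem_std K k) (by rw [hr]; rfl) bound28 small28 Λ hPYZ
  rw [hr] at h
  exact h

/-- **C14 at the standard tower, CLOSED**: `RmSucc (seriesPieces (X.toTowerBase K) 𝔖 (piecesParamsOf S K) k) K.CR` —
the booked coefficient `rcoefOf S K k = CR·g^{6+2κ₀}` times the literal unit `(L^kε)^{3+κ₀}|T₁^{(k)}|` IS `CR·rem_k`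
(`gk_sq_rpow`; `g^{6+2κ₀} = (g²)^{3+κ₀}`).  No hypothesis left. [cite: Balaban1985UV3, (41) p.266] -/
theorem rmSucc_std : RmSucc (seriesPieces (X.toTowerBase K) 𝔖 (piecesParamsOf S K) k) K.CR := by
  refine rmSucc_series (X.toTowerBase K) 𝔖 (piecesParamsOf S K) k K.CR (le_of_eq ?_)
  show K.CR * (piecesParamsOf S K k).rem = rcoefOf S K k * ((L : ℝ) ^ k * S.ε) ^ (3 + K.κ₀) * S.sites k
  have hg : 0 ≤ S.g := S.g_pos.le
  have hpow : S.g ^ ((6 : ℝ) + 2 * K.κ₀) = (S.g ^ 2) ^ (3 + K.κ₀) := by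
    rw [show (6 : ℝ) + 2 * K.κ₀ = 2 * (3 + K.κ₀) by ring, Real.rpow_mul hg, Real.rpow_two]
  rw [piecesParamsOf_rem, gk_sq_rpow, rcoefOf, hpow]
  ring

end Summit.QuantumFields.Balaban3D.Proofs.Run3RepresentationStd

end
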